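import Literature.Barriers.RiemannHypothesis.TuranPartialSumsMontgomeryHankel
import Mathlib.MeasureTheory.Integral.IntervalIntegral.IntegrationByParts
import Mathlib.Analysis.SpecialFunctions.Integrals.Basic
import HarnessLib

/-!
# Montgomery 1983, §4 — real-variable tools for the integral along `Re(s+w) = 1 + 1/log x`

Proofs-only companion of `Literature/Barriers/RiemannHypothesis/TuranPartialSums.lean` (named fact
`Literature.Barriers.RiemannHypothesis.Montgomery1983_theorem`, Montgomery 1983, Theorem p. 497) and of
`TuranPartialSumsMontgomeryHankel.lean`. No definitions, no named facts.

The formalisation evaluates `(1/2πi)∫ f(s+w) x^w dw/w` ((5)/(20) of the source) on the line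
`Re(s+w) = 1 + 1/log x`, splitting it into unit pieces about the heights `k ∈ ℤ` of the singularities
`1 + ik` of `f`; on each piece the main singular factor is `(1/Λ + iv)^{-b̂(k)}` (`Λ = log x`,
`v = Im(s+w) − k`) and the oscillation is `x^{iv} = e^{iΛv}`. This file collects the elementary estimates
used for every piece:

* `norm_integral_mul_exp_le` — one integration by parts against `e^{iΛv}`:
  `‖∫_a^b h e^{iΛv}‖ ≤ (‖h(a)‖ + ‖h(b)‖ + ∫_a^b ‖h'‖)/Λ`;
* `integral_window_kernel_eq` — the window about `k = 1` rescales to the truncated vertical Hankel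
  integral of `TuranPartialSumsMontgomeryHankel.lean`:
  `∫_{-A/Λ}^{A/Λ} (1/Λ + iv)^{-β} e^{iΛv} dv = Λ^{β−1}e^{-1} ∫_{-A}^{A} (1+iy)^{-β}e^{1+iy} dy`;
* `norm_cpow_neg_le_two_mul`, `norm_cpow_neg_le_rpow_max` — `‖(1/Λ + iv)^{-b}‖ ≤ 2|v|^{-b}` off the
  window `|v| ≥ 1/Λ`, and `≤ Λ^{max(b,0)}` on `|v| ≤ 1/2` (`|b| ≤ 1`);
* `abs_mul_integral_rpow_le` (`|b|∫_r^{1/2} v^{-b-1} ≤ r^{-max(b,0)}`), `integral_rpow_neg_le_three`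
  (`∫_r^{1/2} v^{-b} ≤ 3`, `b ≤ 2/3`), and for the piece `k = 0` (where `f` vanishes like `|v|^{β₀}` and the
  kernel has the nearby pole `1/(α + i(v − t))`): `integral_rpow_div_add_le₁`, `integral_rpow_div_add_le₂`,
  `integral_rpow_div_add_sq_le`.

## References

* [Montgomery1983] H. L. Montgomery, *Zeros of approximations to the zeta function*, Studies in Pure
  Mathematics (Turán memorial), Birkhäuser 1983, 497–506: §4, (20)–(24).
-/

noncomputable section

open Complex Set MeasureTheory Filter Topology intervalIntegral
open scoped Interval

namespace Literature.Barriers.RiemannHypothesis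

/-! ## One integration by parts against `e^{iΛv}` -/

/-- **Integration by parts against `e^{iΛv}`**: if `h` has the continuous derivative `h'` on `[a,b]`
and `Λ > 0` then `‖∫_a^b h(v) e^{iΛv} dv‖ ≤ (‖h(a)‖ + ‖h(b)‖ + ∫_a^b ‖h'‖)/Λ`. [folklore] -/
theorem norm_integral_mul_exp_le {h h' : ℝ → ℂ} {a b Λ : ℝ} (hab : a ≤ b) (hΛ : 0 < Λ)
    (hh : ∀ v ∈ Icc a b, HasDerivAt h (h' v) v) (hh' : ContinuousOn h' (Icc a b)) :
    ‖∫ v in a..b, h v * exp (((Λ * v : ℝ) : ℂ) * I)‖ ≤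
      (‖h a‖ + ‖h b‖ + ∫ v in a..b, ‖h' v‖) / Λ := by
  have hΛc : (Λ : ℂ) * I ≠ 0 := mul_ne_zero (ofReal_ne_zero.2 hΛ.ne') I_ne_zero
  -- the primitive `E(v) = e^{iΛv}/(iΛ)` of `e^{iΛv}`
  set E : ℝ → ℂ := fun v ↦ exp (((Λ * v : ℝ) : ℂ) * I) / ((Λ : ℂ) * I) with hE
  have hEd : ∀ v : ℝ, HasDerivAt E (exp (((Λ * v : ℝ) : ℂ) * I)) v := by
    intro v
    have h1 : HasDerivAt (fun v : ℝ ↦ ((Λ * v : ℝ) : ℂ) * I) ((Λ : ℂ) * I) v := by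
      have h2 : HasDerivAt (fun v : ℂ ↦ (Λ : ℂ) * v * I) ((Λ : ℂ) * I) (v : ℂ) := by
        have := ((hasDerivAt_id (v : ℂ)).const_mul (Λ : ℂ)).mul_const I
        simpa using this
      have h3 := h2.comp_ofReal
      refine h3.congr_of_eventuallyEq (Eventually.of_forall fun w ↦ ?_)
      simp
    have h4 := (h1.cexp).div_const ((Λ : ℂ) * I)
    simp only [hE]
    exact h4.congr_deriv (mul_div_cancel_right₀ _ hΛc)
  have hEnorm : ∀ v : ℝ, ‖E v‖ = 1 / Λ := by
    intro v
    simp only [hE, norm_div, norm_exp_ofReal_mul_I, norm_mul, norm_real, Real.norm_eq_abs,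
      abs_of_pos hΛ, norm_I, mul_one]
  -- integrability
  have hcontE : Continuous E := by
    simp only [hE]; fun_prop
  have hcont_exp : Continuous fun v : ℝ ↦ exp (((Λ * v : ℝ) : ℂ) * I) := by fun_prop
  have hh'int : IntervalIntegrable h' volume a b := (hh'.mono (by rw [uIcc_of_le hab])).intervalIntegrable
  have hibp := integral_mul_deriv_eq_deriv_mul (u := h) (v := E) (u' := h')
    (v' := fun v ↦ exp (((Λ * v : ℝ) : ℂ) * I))
    (fun v hv ↦ hh v (by rwa [uIcc_of_le hab] at hv)) (fun v _ ↦ hEd v) hh'int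
    (hcont_exp.intervalIntegrable _ _)
  rw [hibp]
  have h1 : ‖h b * E b - h a * E a‖ ≤ (‖h a‖ + ‖h b‖) / Λ := by
    calc ‖h b * E b - h a * E a‖ ≤ ‖h b * E b‖ + ‖h a * E a‖ := norm_sub_le _ _
      _ = (‖h a‖ + ‖h b‖) / Λ := by rw [norm_mul, norm_mul, hEnorm, hEnorm]; ring
  have h2 : ‖∫ v in a..b, h' v * E v‖ ≤ (∫ v in a..b, ‖h' v‖) / Λ := by
    rw [div_eq_mul_one_div, ← intervalIntegral.integral_mul_const]
    refine intervalIntegral.norm_integral_le_of_norm_le hab (Eventually.of_forall fun v _ ↦ ?_) ?_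
    · rw [norm_mul, hEnorm]
    · exact (hh'int.norm).mul_const _
  calc ‖h b * E b - h a * E a - ∫ v in a..b, h' v * E v‖
      ≤ ‖h b * E b - h a * E a‖ + ‖∫ v in a..b, h' v * E v‖ := norm_sub_le _ _
    _ ≤ (‖h a‖ + ‖h b‖) / Λ + (∫ v in a..b, ‖h' v‖) / Λ := add_le_add h1 h2
    _ = _ := by ring

/-! ## The window kernel rescaled to the Hankel integral -/

/-- **Rescaling the window kernel**: for `Λ > 0`, `A > 0` and real `β`,
`∫_{-A/Λ}^{A/Λ} (1/Λ + iv)^{-β} e^{iΛv} dv = Λ^{β-1} e^{-1} ∫_{-A}^{A} (1+iy)^{-β} e^{1+iy} dy`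
(`v = y/Λ`). [cite: Montgomery1983, §4 (the integral over `Γ₁` after `w ↦ z`)] -/
theorem integral_window_kernel_eq {Λ A : ℝ} (hΛ : 0 < Λ) (hA : 0 < A) (β : ℝ) :
    ∫ v in (-(A / Λ))..(A / Λ), (((1 / Λ : ℝ) : ℂ) + v * I) ^ (-(β : ℂ)) * exp (((Λ * v : ℝ) : ℂ) * I) =
      ((Λ ^ (β - 1) * Real.exp (-1) : ℝ) : ℂ) *
        ∫ y in (-A)..A, ((1 : ℂ) + y * I) ^ (-(β : ℂ)) * exp ((1 : ℂ) + y * I) := by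
  set F : ℝ → ℂ := fun y ↦ ((1 : ℂ) + y * I) ^ (-(β : ℂ)) * exp ((1 : ℂ) + y * I) with hF
  -- pointwise: the integrand at `v` is `Λ^β e^{-1} F(Λ v)`... use `integral_comp_div`
  have hpt : ∀ v : ℝ, (((1 / Λ : ℝ) : ℂ) + v * I) ^ (-(β : ℂ)) * exp (((Λ * v : ℝ) : ℂ) * I) =
      ((Λ ^ β * Real.exp (-1) : ℝ) : ℂ) * F (v / (1 / Λ)) := by
    intro v
    simp only [hF]
    have hΛ0 : (Λ : ℂ) ≠ 0 := ofReal_ne_zero.2 hΛ.ne'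
    have hw : (1 : ℂ) + ((v / (1 / Λ) : ℝ) : ℂ) * I ≠ 0 := by
      intro h; have := congrArg Complex.re h; simp at this
    have hsplit : ((1 / Λ : ℝ) : ℂ) + v * I = ((1 / Λ : ℝ) : ℂ) * ((1 : ℂ) + ((v / (1 / Λ) : ℝ) : ℂ) * I) := by
      push_cast; field_simp
    have hmc : ∀ {r : ℝ} (_ : 0 < r) {w : ℂ} (_ : w ≠ 0) (c : ℂ), ((r : ℂ) * w) ^ c = (r : ℂ) ^ c * w ^ c := by
      intro r hr w hw c
      have hr0 : (r : ℂ) ≠ 0 := ofReal_ne_zero.2 hr.ne'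
      rw [cpow_def_of_ne_zero (mul_ne_zero hr0 hw), cpow_def_of_ne_zero hr0, cpow_def_of_ne_zero hw,
        log_ofReal_mul hr hw, add_mul, exp_add, ofReal_log hr.le]
    rw [hsplit, hmc (by positivity) hw,
      show (((1 / Λ : ℝ) : ℂ)) ^ (-(β : ℂ)) = ((Λ ^ β : ℝ) : ℂ) by
        rw [show (-(β : ℂ)) = ((-β : ℝ) : ℂ) by push_cast; ring, ← ofReal_cpow (by positivity)]
        rw [Real.div_rpow zero_le_one hΛ.le, Real.one_rpow, Real.rpow_neg hΛ.le, one_div, inv_inv],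
      show exp (((Λ * v : ℝ) : ℂ) * I) = ((Real.exp (-1) : ℝ) : ℂ) * exp ((1 : ℂ) + ((v / (1 / Λ) : ℝ) : ℂ) * I) by
        rw [ofReal_exp, ← exp_add]; congr 1; push_cast; field_simp; ring]
    push_cast; ring
  simp_rw [hpt]
  rw [intervalIntegral.integral_const_mul, intervalIntegral.integral_comp_div (f := F) (one_div_ne_zero hΛ.ne')]
  simp only [real_smul]
  have h1 : -(A / Λ) / (1 / Λ) = -A := by field_simp
  have h2 : A / Λ / (1 / Λ) = A := by field_simp
  rw [h1, h2]
  push_cast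
  rw [Real.rpow_sub_one hΛ.ne']
  push_cast
  field_simp

/-! ## The point `w(v) = 1/Λ + iv` of the line relative to the singularity -/

/-- `‖1/Λ + iv‖ ≥ |v|` and `≥ 1/Λ`. [folklore] -/
theorem norm_inv_add_mul_I_ge {Λ : ℝ} (hΛ : 0 < Λ) (v : ℝ) :
    |v| ≤ ‖((1 / Λ : ℝ) : ℂ) + v * I‖ ∧ 1 / Λ ≤ ‖((1 / Λ : ℝ) : ℂ) + v * I‖ := by
  constructor
  · calc |v| = |(((1 / Λ : ℝ) : ℂ) + v * I).im| := by simp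
      _ ≤ _ := abs_im_le_norm _
  · calc 1 / Λ = |(((1 / Λ : ℝ) : ℂ) + v * I).re| := by simp [abs_of_pos hΛ]
      _ ≤ _ := abs_re_le_norm _

/-- `‖1/Λ + iv‖ ≤ 1/Λ + |v|`. [folklore] -/
theorem norm_inv_add_mul_I_le {Λ : ℝ} (hΛ : 0 < Λ) (v : ℝ) :
    ‖((1 / Λ : ℝ) : ℂ) + v * I‖ ≤ 1 / Λ + |v| := by
  calc ‖((1 / Λ : ℝ) : ℂ) + v * I‖ ≤ ‖((1 / Λ : ℝ) : ℂ)‖ + ‖(v : ℂ) * I‖ := norm_add_le _ _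
    _ = 1 / Λ + |v| := by
        rw [norm_real, Real.norm_eq_abs, abs_of_pos (one_div_pos.2 hΛ), norm_mul, norm_real,
          Real.norm_eq_abs, norm_I, mul_one]

/-- `1/Λ + iv ≠ 0`. [folklore] -/
theorem inv_add_mul_I_ne_zero {Λ : ℝ} (hΛ : 0 < Λ) (v : ℝ) : ((1 / Λ : ℝ) : ℂ) + v * I ≠ 0 := by
  intro h
  have := congrArg Complex.re h
  simp [hΛ.ne'] at this

/-- **Off the window**: `‖(1/Λ + iv)^{-b}‖ ≤ 2 |v|^{-b}` for `|v| ≥ 1/Λ` and `|b| ≤ 1`. [folklore] -/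
theorem norm_cpow_neg_le_two_mul {Λ v b : ℝ} (hΛ : 0 < Λ) (hv : 1 / Λ ≤ |v|) (hb : |b| ≤ 1) :
    ‖(((1 / Λ : ℝ) : ℂ) + v * I) ^ (-(b : ℂ))‖ ≤ 2 * |v| ^ (-b) := by
  have hv0 : 0 < |v| := (one_div_pos.2 hΛ).trans_le hv
  rw [norm_cpow_neg_ofReal]
  obtain ⟨h1, _⟩ := norm_inv_add_mul_I_ge hΛ v
  have h2 := norm_inv_add_mul_I_le hΛ v
  rcases le_or_gt 0 b with hb0 | hb0
  · -- `b ≥ 0`: `‖w‖^{-b} ≤ |v|^{-b}`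
    calc ‖((1 / Λ : ℝ) : ℂ) + v * I‖ ^ (-b) ≤ |v| ^ (-b) := Real.rpow_le_rpow_of_nonpos hv0 h1 (by linarith)
      _ ≤ 2 * |v| ^ (-b) := by linarith [Real.rpow_nonneg (abs_nonneg v) (-b)]
  · -- `b < 0`: `‖w‖^{|b|} ≤ (2|v|)^{|b|} ≤ 2 |v|^{|b|}`
    have hw2 : ‖((1 / Λ : ℝ) : ℂ) + v * I‖ ≤ 2 * |v| := by linarith
    calc ‖((1 / Λ : ℝ) : ℂ) + v * I‖ ^ (-b) ≤ (2 * |v|) ^ (-b) :=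
          Real.rpow_le_rpow (norm_nonneg _) hw2 (by linarith)
      _ = (2 : ℝ) ^ (-b) * |v| ^ (-b) := Real.mul_rpow (by norm_num) (abs_nonneg v)
      _ ≤ 2 * |v| ^ (-b) := by
          refine mul_le_mul_of_nonneg_right ?_ (Real.rpow_nonneg (abs_nonneg v) _)
          calc (2 : ℝ) ^ (-b) ≤ (2 : ℝ) ^ (1 : ℝ) :=
                Real.rpow_le_rpow_of_exponent_le (by norm_num) (by linarith [abs_of_neg hb0 ▸ hb])
            _ = 2 := Real.rpow_one _

/-- **On the window**: `‖(1/Λ + iv)^{-b}‖ ≤ Λ^{max(b,0)}` for `|v| ≤ 1/2`, `Λ ≥ 2`. [folklore] -/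
theorem norm_cpow_neg_le_rpow_max {Λ v b : ℝ} (hΛ : 2 ≤ Λ) (hv : |v| ≤ 1 / 2) :
    ‖(((1 / Λ : ℝ) : ℂ) + v * I) ^ (-(b : ℂ))‖ ≤ Λ ^ (max b 0) := by
  have hΛ0 : 0 < Λ := by linarith
  rw [norm_cpow_neg_ofReal]
  obtain ⟨_, h1⟩ := norm_inv_add_mul_I_ge hΛ0 v
  have h2 := norm_inv_add_mul_I_le hΛ0 v
  have hΛinv : 1 / Λ ≤ 1 / 2 := one_div_le_one_div_of_le (by norm_num) hΛ
  rcases le_or_gt 0 b with hb0 | hb0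
  · rw [max_eq_left hb0]
    calc ‖((1 / Λ : ℝ) : ℂ) + v * I‖ ^ (-b) ≤ (1 / Λ) ^ (-b) :=
          Real.rpow_le_rpow_of_nonpos (one_div_pos.2 hΛ0) h1 (by linarith)
      _ = Λ ^ b := by rw [Real.div_rpow zero_le_one hΛ0.le, Real.one_rpow, Real.rpow_neg hΛ0.le, one_div, inv_inv]
  · rw [max_eq_right hb0.le, Real.rpow_zero]
    have hw1 : ‖((1 / Λ : ℝ) : ℂ) + v * I‖ ≤ 1 := by linarith
    exact Real.rpow_le_one (norm_nonneg _) hw1 (by linarith)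

/-! ## Elementary integrals for the pieces -/

/-- `|b| ∫_r^{1/2} v^{-b-1} dv ≤ r^{-max(b,0)}` for `0 < r ≤ 1/2`. [folklore] -/
theorem abs_mul_integral_rpow_le {r b : ℝ} (hr : 0 < r) (hr2 : r ≤ 1 / 2) :
    |b| * ∫ v in r..(1 / 2), v ^ (-b - 1) ≤ r ^ (-(max b 0)) := by
  rcases eq_or_ne b 0 with rfl | hb
  · simp
  have h0 : (0 : ℝ) ∉ [[r, 1 / 2]] := by
    rw [uIcc_of_le hr2]; intro h; exact absurd h.1 (not_le.2 hr)
  rw [integral_rpow (Or.inr ⟨by intro h; apply hb; linarith, h0⟩)]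
  have he : -b - 1 + 1 = -b := by ring
  rw [he]
  rcases lt_or_gt_of_ne hb with hb0 | hb0
  · -- `b < 0`
    rw [max_eq_right hb0.le, neg_zero, Real.rpow_zero, abs_of_neg hb0]
    have h1 : (1 / 2 : ℝ) ^ (-b) ≤ 1 := Real.rpow_le_one (by norm_num) (by norm_num) (by linarith)
    have h2 : 0 ≤ r ^ (-b) := Real.rpow_nonneg hr.le _
    have : -b * (((1 / 2 : ℝ) ^ (-b) - r ^ (-b)) / -b) = (1 / 2 : ℝ) ^ (-b) - r ^ (-b) := by
      field_simp
    rw [this]; linarith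
  · -- `b > 0`
    rw [max_eq_left hb0.le, abs_of_pos hb0]
    have h1 : 0 ≤ (1 / 2 : ℝ) ^ (-b) := Real.rpow_nonneg (by norm_num) _
    have : b * (((1 / 2 : ℝ) ^ (-b) - r ^ (-b)) / -b) = r ^ (-b) - (1 / 2 : ℝ) ^ (-b) := by
      field_simp; ring
    rw [this]; linarith

/-- `∫_r^{1/2} v^{-b} dv ≤ 3` for `0 < r ≤ 1/2` and `b ≤ 2/3`. [folklore] -/
theorem integral_rpow_neg_le_three {r b : ℝ} (hr : 0 < r) (hr2 : r ≤ 1 / 2) (hb : b ≤ 2 / 3) :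
    ∫ v in r..(1 / 2), v ^ (-b) ≤ 3 := by
  have h0 : (0 : ℝ) ∉ [[r, 1 / 2]] := by
    rw [uIcc_of_le hr2]; intro h; exact absurd h.1 (not_le.2 hr)
  rw [integral_rpow (Or.inr ⟨by intro h; linarith, h0⟩)]
  have hb1 : 0 < -b + 1 := by linarith
  have h1 : (1 / 2 : ℝ) ^ (-b + 1) ≤ 1 := Real.rpow_le_one (by norm_num) (by norm_num) hb1.le
  have h2 : 0 ≤ r ^ (-b + 1) := Real.rpow_nonneg hr.le _
  rw [div_le_iff₀ hb1]
  nlinarith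

/-- `∫_a^b v^p dv ≤ b^{p+1}/(p+1)` for `0 < a ≤ b` and `p > -1`. [folklore] -/
theorem integral_rpow_le_of_neg_one_lt {a p : ℝ} (b : ℝ) (ha : 0 < a) (hp : -1 < p) :
    ∫ v in a..b, v ^ p ≤ b ^ (p + 1) / (p + 1) := by
  rw [integral_rpow (Or.inl hp)]
  have : 0 ≤ a ^ (p + 1) := Real.rpow_nonneg ha.le _
  rw [div_le_div_iff_of_pos_right (by linarith)]
  linarith

/-- `∫_a^b v^p dv ≤ a^{p+1}/(-(p+1))` for `0 < a ≤ b` and `p < -1`. [folklore] -/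
theorem integral_rpow_le_of_lt_neg_one {a b p : ℝ} (ha : 0 < a) (hab : a ≤ b) (hp : p < -1) :
    ∫ v in a..b, v ^ p ≤ a ^ (p + 1) / (-(p + 1)) := by
  have h0 : (0 : ℝ) ∉ [[a, b]] := by
    rw [uIcc_of_le hab]; intro h; exact absurd h.1 (not_le.2 ha)
  rw [integral_rpow (Or.inr ⟨by linarith, h0⟩)]
  have hb : 0 ≤ b ^ (p + 1) := Real.rpow_nonneg (by linarith) _
  have hp1 : p + 1 ≠ 0 := by linarith
  have : (b ^ (p + 1) - a ^ (p + 1)) / (p + 1) = (a ^ (p + 1) - b ^ (p + 1)) / (-(p + 1)) := by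
    field_simp; ring
  rw [this]
  exact div_le_div_of_nonneg_right (by linarith) (by linarith)

/-- `v ↦ v^p` is interval integrable on `[c, d]` for `0 < c ≤ d`. [folklore] -/
theorem intervalIntegrable_rpow_of_pos (p : ℝ) {c d : ℝ} (hc : 0 < c) (hcd : c ≤ d) :
    IntervalIntegrable (fun v : ℝ ↦ v ^ p) volume c d := by
  refine ContinuousOn.intervalIntegrable_of_Icc hcd fun v hv ↦ ?_
  exact (Real.continuousAt_rpow_const _ _ (Or.inl (hc.trans_le hv.1).ne')).continuousWithinAt

/-- **`k = 0`, first integral**: `∫_r^{1/2} v^{β₀−1}/(a+v) dv ≤ a^{β₀−1}(1/β₀ + 1/(1−β₀))` for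
`0 < r ≤ a ≤ 1/2`, `0 < β₀ < 1`. [folklore] -/
theorem integral_rpow_div_add_le₁ {r a β₀ : ℝ} (hr : 0 < r) (hra : r ≤ a) (ha : a ≤ 1 / 2)
    (hβ₀ : 0 < β₀) (hβ₁ : β₀ < 1) :
    ∫ v in r..(1 / 2), v ^ (β₀ - 1) / (a + v) ≤ a ^ (β₀ - 1) * (1 / β₀ + 1 / (1 - β₀)) := by
  have ha0 : 0 < a := hr.trans_le hra
  have hcont : ∀ c d : ℝ, 0 < c → ContinuousOn (fun v : ℝ ↦ v ^ (β₀ - 1) / (a + v)) (Icc c d) := by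
    intro c d hc v hv
    have hv0 : 0 < v := hc.trans_le hv.1
    exact ((Real.continuousAt_rpow_const _ _ (Or.inl hv0.ne')).div (by fun_prop) (by linarith)).continuousWithinAt
  have hint : ∀ c d : ℝ, 0 < c → c ≤ d → IntervalIntegrable (fun v : ℝ ↦ v ^ (β₀ - 1) / (a + v)) volume c d :=
    fun c d hc hcd ↦ (hcont c d hc).intervalIntegrable_of_Icc hcd
  rw [← integral_add_adjacent_intervals (hint r a hr hra) (hint a (1 / 2) ha0 ha)]
  -- `[r, a]`: bound by `v^{β₀-1}/a`
  have h1 : ∫ v in r..a, v ^ (β₀ - 1) / (a + v) ≤ a ^ (β₀ - 1) / β₀ := by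
    have hle : ∫ v in r..a, v ^ (β₀ - 1) / (a + v) ≤ ∫ v in r..a, v ^ (β₀ - 1) / a := by
      refine intervalIntegral.integral_mono_on hra (hint r a hr hra) ?_ fun v hv ↦ ?_
      · exact (intervalIntegrable_rpow_of_pos _ hr hra).div_const a
      · have hv0 : 0 < v := hr.trans_le hv.1
        exact div_le_div_of_nonneg_left (Real.rpow_nonneg hv0.le _) ha0 (by linarith)
    refine hle.trans ?_
    rw [intervalIntegral.integral_div]
    have h2 := integral_rpow_le_of_neg_one_lt a hr (by linarith : -1 < β₀ - 1)
    rw [show β₀ - 1 + 1 = β₀ by ring] at h2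
    calc (∫ v in r..a, v ^ (β₀ - 1)) / a ≤ (a ^ β₀ / β₀) / a := div_le_div_of_nonneg_right h2 ha0.le
      _ = a ^ (β₀ - 1) / β₀ := by rw [Real.rpow_sub_one ha0.ne']; field_simp
  -- `[a, 1/2]`: bound by `v^{β₀-2}`
  have h2 : ∫ v in a..(1 / 2), v ^ (β₀ - 1) / (a + v) ≤ a ^ (β₀ - 1) / (1 - β₀) := by
    have hle : ∫ v in a..(1 / 2), v ^ (β₀ - 1) / (a + v) ≤ ∫ v in a..(1 / 2), v ^ (β₀ - 2) := by
      refine intervalIntegral.integral_mono_on ha (hint a _ ha0 ha) ?_ fun v hv ↦ ?_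
      · exact intervalIntegrable_rpow_of_pos _ ha0 ha
      · have hv0 : 0 < v := ha0.trans_le hv.1
        rw [div_le_iff₀ (by linarith), show β₀ - 2 = (β₀ - 1) + (-1 : ℝ) by ring, Real.rpow_add hv0,
          Real.rpow_neg_one]
        have : 0 ≤ v ^ (β₀ - 1) := Real.rpow_nonneg hv0.le _
        rw [mul_assoc]
        refine le_mul_of_one_le_right this ?_
        rw [inv_mul_eq_div, le_div_iff₀ hv0]; linarith
    refine hle.trans ?_
    have h3 := integral_rpow_le_of_lt_neg_one ha0 ha (by linarith : β₀ - 2 < -1)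
    rw [show β₀ - 2 + 1 = β₀ - 1 by ring, show -(β₀ - 1) = 1 - β₀ by ring] at h3
    exact h3
  calc (∫ v in r..a, v ^ (β₀ - 1) / (a + v)) + ∫ v in a..(1 / 2), v ^ (β₀ - 1) / (a + v)
      ≤ a ^ (β₀ - 1) / β₀ + a ^ (β₀ - 1) / (1 - β₀) := add_le_add h1 h2
    _ = _ := by ring

/-- **`k = 0`, second integral**: `∫_r^{1/2} v^{β₀}/(a+v) dv ≤ 1/β₀` (`0 < r ≤ 1/2`, `a > 0`, `0 < β₀`).
[folklore] -/
theorem integral_rpow_div_add_le₂ {r a β₀ : ℝ} (hr : 0 < r) (hr2 : r ≤ 1 / 2) (ha : 0 < a) (hβ₀ : 0 < β₀) :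
    ∫ v in r..(1 / 2), v ^ β₀ / (a + v) ≤ 1 / β₀ := by
  have hle : ∫ v in r..(1 / 2), v ^ β₀ / (a + v) ≤ ∫ v in r..(1 / 2), v ^ (β₀ - 1) := by
    refine intervalIntegral.integral_mono_on hr2 ?_ ?_ fun v hv ↦ ?_
    · refine ContinuousOn.intervalIntegrable_of_Icc hr2 fun v hv ↦ ?_
      have hv0 : 0 < v := hr.trans_le hv.1
      exact ((Real.continuousAt_rpow_const _ _ (Or.inl hv0.ne')).div (by fun_prop) (by linarith)).continuousWithinAt
    · exact intervalIntegrable_rpow_of_pos _ hr hr2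
    · have hv0 : 0 < v := hr.trans_le hv.1
      rw [div_le_iff₀ (by linarith), Real.rpow_sub_one hv0.ne']
      have : 0 ≤ v ^ β₀ := Real.rpow_nonneg hv0.le _
      rw [div_mul_eq_mul_div, le_div_iff₀ hv0]
      nlinarith
  refine hle.trans ?_
  have h2 := integral_rpow_le_of_neg_one_lt (1 / 2) hr (by linarith : -1 < β₀ - 1)
  rw [show β₀ - 1 + 1 = β₀ by ring] at h2
  refine h2.trans ?_
  have : (1 / 2 : ℝ) ^ β₀ ≤ 1 := Real.rpow_le_one (by norm_num) (by norm_num) hβ₀.le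
  exact div_le_div_of_nonneg_right this hβ₀.le

/-- **`k = 0`, third integral**: `∫_r^{1/2} v^{β₀}/(a+v)² dv ≤ a^{β₀−1}(1 + 1/(1−β₀))`
(`0 < r ≤ a ≤ 1/2`, `0 < β₀ < 1`). [folklore] -/
theorem integral_rpow_div_add_sq_le {r a β₀ : ℝ} (hr : 0 < r) (hra : r ≤ a) (ha : a ≤ 1 / 2)
    (hβ₀ : 0 < β₀) (hβ₁ : β₀ < 1) :
    ∫ v in r..(1 / 2), v ^ β₀ / (a + v) ^ 2 ≤ a ^ (β₀ - 1) * (1 + 1 / (1 - β₀)) := by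
  have ha0 : 0 < a := hr.trans_le hra
  have hcont : ∀ c d : ℝ, 0 < c → ContinuousOn (fun v : ℝ ↦ v ^ β₀ / (a + v) ^ 2) (Icc c d) := by
    intro c d hc v hv
    have hv0 : 0 < v := hc.trans_le hv.1
    exact ((Real.continuousAt_rpow_const _ _ (Or.inl hv0.ne')).div (by fun_prop) (by positivity)).continuousWithinAt
  have hint : ∀ c d : ℝ, 0 < c → c ≤ d → IntervalIntegrable (fun v : ℝ ↦ v ^ β₀ / (a + v) ^ 2) volume c d :=
    fun c d hc hcd ↦ (hcont c d hc).intervalIntegrable_of_Icc hcd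
  have hpow_int : ∀ c d p : ℝ, 0 < c → c ≤ d → IntervalIntegrable (fun v : ℝ ↦ v ^ p) volume c d :=
    fun c d p hc hcd ↦ intervalIntegrable_rpow_of_pos p hc hcd
  rw [← integral_add_adjacent_intervals (hint r a hr hra) (hint a (1 / 2) ha0 ha)]
  have h1 : ∫ v in r..a, v ^ β₀ / (a + v) ^ 2 ≤ a ^ (β₀ - 1) := by
    have hle : ∫ v in r..a, v ^ β₀ / (a + v) ^ 2 ≤ ∫ v in r..a, v ^ β₀ / a ^ 2 := by
      refine intervalIntegral.integral_mono_on hra (hint r a hr hra) ((hpow_int r a β₀ hr hra).div_const _)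
        fun v hv ↦ ?_
      have hv0 : 0 < v := hr.trans_le hv.1
      exact div_le_div_of_nonneg_left (Real.rpow_nonneg hv0.le _) (by positivity)
        (pow_le_pow_left₀ ha0.le (by linarith) 2)
    refine hle.trans ?_
    rw [intervalIntegral.integral_div]
    have h2 := integral_rpow_le_of_neg_one_lt a hr (by linarith : -1 < β₀)
    calc (∫ v in r..a, v ^ β₀) / a ^ 2 ≤ (a ^ (β₀ + 1) / (β₀ + 1)) / a ^ 2 :=
          div_le_div_of_nonneg_right h2 (by positivity)
      _ ≤ a ^ (β₀ + 1) / a ^ 2 := by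
          refine div_le_div_of_nonneg_right ?_ (by positivity)
          exact div_le_self (Real.rpow_nonneg ha0.le _) (by linarith)
      _ = a ^ (β₀ - 1) := by
          rw [show β₀ + 1 = (β₀ - 1) + 2 by ring, Real.rpow_add ha0, Real.rpow_two]; field_simp
  have h2 : ∫ v in a..(1 / 2), v ^ β₀ / (a + v) ^ 2 ≤ a ^ (β₀ - 1) / (1 - β₀) := by
    have hle : ∫ v in a..(1 / 2), v ^ β₀ / (a + v) ^ 2 ≤ ∫ v in a..(1 / 2), v ^ (β₀ - 2) := by
      refine intervalIntegral.integral_mono_on ha (hint a _ ha0 ha) (hpow_int a _ _ ha0 ha) fun v hv ↦ ?_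
      have hv0 : 0 < v := ha0.trans_le hv.1
      rw [div_le_iff₀ (by positivity), show β₀ - 2 = β₀ + (-2 : ℝ) by ring, Real.rpow_add hv0,
        show (-2 : ℝ) = -((2 : ℕ) : ℝ) by norm_num, Real.rpow_neg hv0.le, Real.rpow_natCast, mul_assoc]
      refine le_mul_of_one_le_right (Real.rpow_nonneg hv0.le _) ?_
      rw [inv_mul_eq_div, le_div_iff₀ (by positivity)]
      nlinarith
    refine hle.trans ?_
    have h3 := integral_rpow_le_of_lt_neg_one ha0 ha (by linarith : β₀ - 2 < -1)
    rw [show β₀ - 2 + 1 = β₀ - 1 by ring, show -(β₀ - 1) = 1 - β₀ by ring] at h3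
    exact h3
  have ha1 : 0 ≤ a ^ (β₀ - 1) := Real.rpow_nonneg ha0.le _
  calc (∫ v in r..a, v ^ β₀ / (a + v) ^ 2) + ∫ v in a..(1 / 2), v ^ β₀ / (a + v) ^ 2
      ≤ a ^ (β₀ - 1) + a ^ (β₀ - 1) / (1 - β₀) := add_le_add h1 h2
    _ = _ := by ring

end Literature.Barriers.RiemannHypothesis

end
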